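import Mathlib.Data.Finset.Card
import Mathlib.Data.Finset.Prod
import Mathlib.Order.Interval.Finset.Nat
import Mathlib.Order.SymmDiff
import HarnessLib

/-!
# Bundle words: thread words, the split/join of the last thread, complements (glue for H≼_J on all bundles, layer 1)

Support file (`--supports stmt-CriticalPhenomena-4575`, closed), prover `prim-cplus-coupling` (gen 52).  No definitions, no notations,
no named facts, no sorries; standard axioms.  Memo `prim-cplus-coupling/A5-COUPLING-gen50.md` §2.6 (closure lemma), `A5-COUPLING-gen51.md` §7.

WORD FORM OF A BUNDLE `Θ(ℓ 0, …, ℓ (r-1))` (hubs `u = w_t(0)`, `b = w_t(ℓ t)`): a colouring is the finite set `ω ⊆ E r` of its RED edges,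
edge `(t, k)` being the `k`-th edge of thread `t` (`t < r`, `1 ≤ k ≤ ℓ t`); everything is hypothesis-style:
`hE : p ∈ E n ↔ p.1 < n ∧ 1 ≤ p.2 ∧ p.2 ≤ ℓ p.1` and the thread words `hθ : k ∈ θ t ω ↔ (t, k) ∈ ω`.
This file is the set algebra of the decomposition `Θ_{r+1} = Θ_r ∥ P_r` used by the thread induction (memo-50 §2.6):
the join `ω' ∪ ζ.image (Prod.mk r)` of a word `ω' ⊆ E r` with a path word `ζ ⊆ [1, ℓ r]`, its thread words, the split of a word
`ω ⊆ E (r+1)` into `(ω.filter (·.1 < r), θ r ω)`, injectivity, and the behaviour of complements `E n \ ·` (and of the involution `· ∆ E n`,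
which is the complement on subwords) under the join.
[cite: KozmaNitzan2024, Questions 8–9 (§5.5 p. 36) (context)]
-/

namespace Summit.CriticalPhenomena.PercolationContinuityZ3.Theorems

open Finset
open scoped symmDiff

namespace Coefficientwise

/-- Membership in the embedded copy `ζ.image (Prod.mk t)` of a path word. [folklore] -/
theorem hubB_mem_image_mk (ζ : Finset ℕ) (t : ℕ) (p : ℕ × ℕ) :
    p ∈ ζ.image (Prod.mk t) ↔ p.1 = t ∧ p.2 ∈ ζ := by
  constructor
  · intro h
    obtain ⟨k, hk, rfl⟩ := Finset.mem_image.mp h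
    exact ⟨rfl, hk⟩
  · rintro ⟨h1, h2⟩
    exact Finset.mem_image.mpr ⟨p.2, h2, by rw [← h1]⟩

/-- The thread word of an embedded path word on its own thread is the path word. [folklore] -/
theorem hubB_theta_image_self (θ : ℕ → Finset (ℕ × ℕ) → Finset ℕ) (hθ : ∀ t ω k, k ∈ θ t ω ↔ (t, k) ∈ ω)
    (ζ : Finset ℕ) (t : ℕ) : θ t (ζ.image (Prod.mk t)) = ζ := by
  ext k
  rw [hθ, hubB_mem_image_mk]
  simp

/-- The thread word of an embedded path word on another thread is empty. [folklore] -/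
theorem hubB_theta_image_ne (θ : ℕ → Finset (ℕ × ℕ) → Finset ℕ) (hθ : ∀ t ω k, k ∈ θ t ω ↔ (t, k) ∈ ω)
    (ζ : Finset ℕ) (s t : ℕ) (hst : t ≠ s) : θ t (ζ.image (Prod.mk s)) = ∅ := by
  ext k
  rw [hθ, hubB_mem_image_mk]
  simp only [Finset.notMem_empty, iff_false, not_and]
  intro h; exact absurd h hst

/-- Thread words are additive under union. [folklore] -/
theorem hubB_theta_union (θ : ℕ → Finset (ℕ × ℕ) → Finset ℕ) (hθ : ∀ t ω k, k ∈ θ t ω ↔ (t, k) ∈ ω)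
    (x y : Finset (ℕ × ℕ)) (t : ℕ) : θ t (x ∪ y) = θ t x ∪ θ t y := by
  ext k
  rw [hθ, Finset.mem_union, Finset.mem_union, hθ, hθ]

/-- Thread words are monotone. [folklore] -/
theorem hubB_theta_mono (θ : ℕ → Finset (ℕ × ℕ) → Finset ℕ) (hθ : ∀ t ω k, k ∈ θ t ω ↔ (t, k) ∈ ω)
    (x y : Finset (ℕ × ℕ)) (hxy : x ⊆ y) (t : ℕ) : θ t x ⊆ θ t y := by
  intro k hk
  rw [hθ] at hk ⊢
  exact hxy hk

/-- A word of `Θ_r` has empty thread words beyond `r`. [folklore] -/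
theorem hubB_theta_of_ge (ℓ : ℕ → ℕ) (E : ℕ → Finset (ℕ × ℕ)) (hE : ∀ n p, p ∈ E n ↔ p.1 < n ∧ 1 ≤ p.2 ∧ p.2 ≤ ℓ p.1)
    (θ : ℕ → Finset (ℕ × ℕ) → Finset ℕ) (hθ : ∀ t ω k, k ∈ θ t ω ↔ (t, k) ∈ ω)
    (r : ℕ) (ω : Finset (ℕ × ℕ)) (hω : ω ⊆ E r) (t : ℕ) (ht : r ≤ t) : θ t ω = ∅ := by
  ext k
  simp only [Finset.notMem_empty, iff_false]
  intro hk
  rw [hθ] at hk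
  have := ((hE r _).mp (hω hk)).1
  simp at this; omega

/-- Thread words of a word of `Θ_r` lie in `[1, ℓ t]`. [folklore] -/
theorem hubB_theta_sub (ℓ : ℕ → ℕ) (E : ℕ → Finset (ℕ × ℕ)) (hE : ∀ n p, p ∈ E n ↔ p.1 < n ∧ 1 ≤ p.2 ∧ p.2 ≤ ℓ p.1)
    (θ : ℕ → Finset (ℕ × ℕ) → Finset ℕ) (hθ : ∀ t ω k, k ∈ θ t ω ↔ (t, k) ∈ ω)
    (r : ℕ) (ω : Finset (ℕ × ℕ)) (hω : ω ⊆ E r) (t : ℕ) : θ t ω ⊆ Icc 1 (ℓ t) := by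
  intro k hk
  rw [hθ] at hk
  have := (hE r _).mp (hω hk)
  exact Finset.mem_Icc.mpr ⟨this.2.1, this.2.2⟩

/-- `E r ⊆ E (r+1)` and the new edges are the embedded path `[1, ℓ r]`. [folklore] -/
theorem hubB_mem_E_succ (ℓ : ℕ → ℕ) (E : ℕ → Finset (ℕ × ℕ)) (hE : ∀ n p, p ∈ E n ↔ p.1 < n ∧ 1 ≤ p.2 ∧ p.2 ≤ ℓ p.1)
    (r : ℕ) (p : ℕ × ℕ) : p ∈ E (r + 1) ↔ p ∈ E r ∨ p ∈ (Icc 1 (ℓ r)).image (Prod.mk r) := by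
  rw [hE, hE, hubB_mem_image_mk, Finset.mem_Icc]
  constructor
  · rintro ⟨h1, h2, h3⟩
    by_cases h : p.1 < r
    · exact Or.inl ⟨h, h2, h3⟩
    · have hp : p.1 = r := by omega
      exact Or.inr ⟨hp, by rw [← hp]; exact ⟨h2, h3⟩⟩
  · rintro (⟨h1, h2, h3⟩ | ⟨h1, h2, h3⟩)
    · exact ⟨by omega, h2, h3⟩
    · refine ⟨by omega, ?_, ?_⟩
      · exact h2
      · rw [h1]; exact h3

/-- The join of a word of `Θ_r` and a path word is a word of `Θ_{r+1}`. [folklore] -/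
theorem hubB_join_sub (ℓ : ℕ → ℕ) (E : ℕ → Finset (ℕ × ℕ)) (hE : ∀ n p, p ∈ E n ↔ p.1 < n ∧ 1 ≤ p.2 ∧ p.2 ≤ ℓ p.1)
    (r : ℕ) (ω' : Finset (ℕ × ℕ)) (hω' : ω' ⊆ E r) (ζ : Finset ℕ) (hζ : ζ ⊆ Icc 1 (ℓ r)) :
    ω' ∪ ζ.image (Prod.mk r) ⊆ E (r + 1) := by
  intro p hp
  rw [hubB_mem_E_succ ℓ E hE]
  rcases Finset.mem_union.mp hp with h | h
  · exact Or.inl (hω' h)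
  · right
    rw [hubB_mem_image_mk] at h ⊢
    exact ⟨h.1, hζ h.2⟩

/-- Thread words of a join: the old threads. [folklore] -/
theorem hubB_theta_join_ne (θ : ℕ → Finset (ℕ × ℕ) → Finset ℕ) (hθ : ∀ t ω k, k ∈ θ t ω ↔ (t, k) ∈ ω)
    (r : ℕ) (ω' : Finset (ℕ × ℕ)) (ζ : Finset ℕ) (t : ℕ) (ht : t ≠ r) :
    θ t (ω' ∪ ζ.image (Prod.mk r)) = θ t ω' := by
  rw [hubB_theta_union θ hθ, hubB_theta_image_ne θ hθ ζ r t ht, Finset.union_empty]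

/-- Thread words of a join: the new thread. [folklore] -/
theorem hubB_theta_join_self (ℓ : ℕ → ℕ) (E : ℕ → Finset (ℕ × ℕ)) (hE : ∀ n p, p ∈ E n ↔ p.1 < n ∧ 1 ≤ p.2 ∧ p.2 ≤ ℓ p.1)
    (θ : ℕ → Finset (ℕ × ℕ) → Finset ℕ) (hθ : ∀ t ω k, k ∈ θ t ω ↔ (t, k) ∈ ω)
    (r : ℕ) (ω' : Finset (ℕ × ℕ)) (hω' : ω' ⊆ E r) (ζ : Finset ℕ) :
    θ r (ω' ∪ ζ.image (Prod.mk r)) = ζ := by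
  rw [hubB_theta_union θ hθ, hubB_theta_of_ge ℓ E hE θ hθ r ω' hω' r (le_refl _), hubB_theta_image_self θ hθ,
    Finset.empty_union]

/-- The first component of a join. [folklore] -/
theorem hubB_fst_join (ℓ : ℕ → ℕ) (E : ℕ → Finset (ℕ × ℕ)) (hE : ∀ n p, p ∈ E n ↔ p.1 < n ∧ 1 ≤ p.2 ∧ p.2 ≤ ℓ p.1)
    (r : ℕ) (ω' : Finset (ℕ × ℕ)) (hω' : ω' ⊆ E r) (ζ : Finset ℕ) :
    (ω' ∪ ζ.image (Prod.mk r)).filter (fun p => p.1 < r) = ω' := by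
  ext p
  rw [Finset.mem_filter, Finset.mem_union, hubB_mem_image_mk]
  constructor
  · rintro ⟨h | h, hlt⟩
    · exact h
    · exfalso; omega
  · intro h
    exact ⟨Or.inl h, ((hE r p).mp (hω' h)).1⟩

/-- **Split.**  A word of `Θ_{r+1}` is the join of its restriction to `Θ_r` and its last thread word. [folklore] -/
theorem hubB_split (ℓ : ℕ → ℕ) (E : ℕ → Finset (ℕ × ℕ)) (hE : ∀ n p, p ∈ E n ↔ p.1 < n ∧ 1 ≤ p.2 ∧ p.2 ≤ ℓ p.1)
    (θ : ℕ → Finset (ℕ × ℕ) → Finset ℕ) (hθ : ∀ t ω k, k ∈ θ t ω ↔ (t, k) ∈ ω)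
    (r : ℕ) (ω : Finset (ℕ × ℕ)) (hω : ω ⊆ E (r + 1)) :
    ω = ω.filter (fun p => p.1 < r) ∪ (θ r ω).image (Prod.mk r) ∧
      ω.filter (fun p => p.1 < r) ⊆ E r ∧ θ r ω ⊆ Icc 1 (ℓ r) := by
  refine ⟨?_, ?_, hubB_theta_sub ℓ E hE θ hθ (r + 1) ω hω r⟩
  · ext p
    rw [Finset.mem_union, Finset.mem_filter, hubB_mem_image_mk, hθ]
    constructor
    · intro hp
      have h1 := ((hE (r + 1) p).mp (hω hp)).1
      by_cases h : p.1 < r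
      · exact Or.inl ⟨hp, h⟩
      · right
        have hp1 : p.1 = r := by omega
        refine ⟨hp1, ?_⟩
        rw [← hp1]; exact hp
    · rintro (⟨hp, _⟩ | ⟨hp1, hp2⟩)
      · exact hp
      · have : (r, p.2) = p := by rw [← hp1]
        rw [this] at hp2; exact hp2
  · intro p hp
    rw [Finset.mem_filter] at hp
    have h := (hE (r + 1) p).mp (hω hp.1)
    exact (hE r p).mpr ⟨hp.2, h.2.1, h.2.2⟩

/-- **The join is injective** on (words of `Θ_r`) × (path words). [folklore] -/
theorem hubB_join_inj (ℓ : ℕ → ℕ) (E : ℕ → Finset (ℕ × ℕ)) (hE : ∀ n p, p ∈ E n ↔ p.1 < n ∧ 1 ≤ p.2 ∧ p.2 ≤ ℓ p.1)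
    (θ : ℕ → Finset (ℕ × ℕ) → Finset ℕ) (hθ : ∀ t ω k, k ∈ θ t ω ↔ (t, k) ∈ ω)
    (r : ℕ) (x x' : Finset (ℕ × ℕ)) (hx : x ⊆ E r) (hx' : x' ⊆ E r) (ζ ζ' : Finset ℕ)
    (h : x ∪ ζ.image (Prod.mk r) = x' ∪ ζ'.image (Prod.mk r)) : x = x' ∧ ζ = ζ' := by
  constructor
  · rw [← hubB_fst_join ℓ E hE r x hx ζ, ← hubB_fst_join ℓ E hE r x' hx' ζ', h]
  · rw [← hubB_theta_join_self ℓ E hE θ hθ r x hx ζ, ← hubB_theta_join_self ℓ E hE θ hθ r x' hx' ζ', h]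

/-- Thread words of a complement. [folklore] -/
theorem hubB_theta_sdiff (ℓ : ℕ → ℕ) (E : ℕ → Finset (ℕ × ℕ)) (hE : ∀ n p, p ∈ E n ↔ p.1 < n ∧ 1 ≤ p.2 ∧ p.2 ≤ ℓ p.1)
    (θ : ℕ → Finset (ℕ × ℕ) → Finset ℕ) (hθ : ∀ t ω k, k ∈ θ t ω ↔ (t, k) ∈ ω)
    (n : ℕ) (ω : Finset (ℕ × ℕ)) (t : ℕ) (ht : t < n) : θ t (E n \ ω) = Icc 1 (ℓ t) \ θ t ω := by
  ext k
  rw [hθ, Finset.mem_sdiff, Finset.mem_sdiff, hE, hθ, Finset.mem_Icc]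
  constructor
  · rintro ⟨⟨_, h2, h3⟩, h4⟩; exact ⟨⟨h2, h3⟩, h4⟩
  · rintro ⟨⟨h2, h3⟩, h4⟩; exact ⟨⟨ht, h2, h3⟩, h4⟩

/-- **Complement of a join** = join of the complements. [folklore] -/
theorem hubB_compl_join (ℓ : ℕ → ℕ) (E : ℕ → Finset (ℕ × ℕ)) (hE : ∀ n p, p ∈ E n ↔ p.1 < n ∧ 1 ≤ p.2 ∧ p.2 ≤ ℓ p.1)
    (r : ℕ) (ω' : Finset (ℕ × ℕ)) (hω' : ω' ⊆ E r) (ζ : Finset ℕ) :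
    E (r + 1) \ (ω' ∪ ζ.image (Prod.mk r)) = (E r \ ω') ∪ (Icc 1 (ℓ r) \ ζ).image (Prod.mk r) := by
  ext p
  rw [Finset.mem_sdiff, hubB_mem_E_succ ℓ E hE, Finset.mem_union, Finset.mem_union, Finset.mem_sdiff,
    hubB_mem_image_mk, hubB_mem_image_mk, hubB_mem_image_mk, Finset.mem_sdiff]
  have hr : p ∈ E r → p.1 < r := fun h => ((hE r p).mp h).1
  have hr' : p ∈ ω' → p.1 < r := fun h => hr (hω' h)
  constructor
  · rintro ⟨h1 | ⟨h1, h2⟩, h3⟩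
    · left; exact ⟨h1, fun h => h3 (Or.inl h)⟩
    · right; exact ⟨h1, h2, fun h => h3 (Or.inr ⟨h1, h⟩)⟩
  · rintro (⟨h1, h2⟩ | ⟨h1, h2, h3⟩)
    · refine ⟨Or.inl h1, ?_⟩
      rintro (h | ⟨h4, _⟩)
      · exact h2 h
      · have := hr h1; omega
    · refine ⟨Or.inr ⟨h1, h2⟩, ?_⟩
      rintro (h | ⟨_, h4⟩)
      · have := hr' h; omega
      · exact h3 h4

/-- On subwords the involution `· ∆ E` is the complement. [folklore] -/
theorem hubB_symmDiff_eq_sdiff {γ : Type*} [DecidableEq γ] (E ω : Finset γ) (hω : ω ⊆ E) : ω ∆ E = E \ ω := by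
  ext p
  rw [Finset.mem_symmDiff, Finset.mem_sdiff]
  constructor
  · rintro (⟨h1, h2⟩ | ⟨h1, h2⟩)
    · exact absurd (hω h1) h2
    · exact ⟨h1, h2⟩
  · rintro ⟨h1, h2⟩; exact Or.inr ⟨h1, h2⟩

/-- `· ∆ E` is an involution. [folklore] -/
theorem hubB_symmDiff_invol {γ : Type*} [DecidableEq γ] (E : Finset γ) : Function.Involutive (fun ω : Finset γ => ω ∆ E) := by
  intro ω
  show ω ∆ E ∆ E = ω
  rw [symmDiff_assoc, symmDiff_self, symmDiff_bot]

/-- A hub move on an old thread of a join is a hub move of the join (set algebra). [folklore] -/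
theorem hubB_join_move_old (r : ℕ) (ω' M : Finset (ℕ × ℕ)) (ζ : Finset ℕ) :
    (ω' ∪ ζ.image (Prod.mk r)) ∪ M = (ω' ∪ M) ∪ ζ.image (Prod.mk r) := by
  rw [Finset.union_assoc, Finset.union_comm (ζ.image _) M, ← Finset.union_assoc]

/-- A hub move on the new thread of a join is a hub move of the join (set algebra). [folklore] -/
theorem hubB_join_move_new (r : ℕ) (ω' : Finset (ℕ × ℕ)) (ζ : Finset ℕ) (a b L : ℕ) :
    (ω' ∪ ζ.image (Prod.mk r)) ∪ (Icc 1 a ∪ Icc (b + 1) L).image (Prod.mk r) =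
      ω' ∪ (ζ ∪ Icc 1 a ∪ Icc (b + 1) L).image (Prod.mk r) := by
  rw [Finset.union_assoc, ← Finset.image_union, Finset.union_assoc ζ]

end Coefficientwise

end Summit.CriticalPhenomena.PercolationContinuityZ3.Theorems
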